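import Summits.QuantumFields.BalabanUV.T4Continuum.Support.VariationalColourTaxiOneMinDecay
import Summits.QuantumFields.BalabanUV.T4Continuum.Support.VariationalColourTaxiClassReadings

/-!
# T⁴ programme, spine node NE2 (U1a), lane P2 — «V-AVG-G AT TAXI DATA», file 8: THE (ONE-min) COSTS AT BAŁABAN's TAXI DATA DECAY LIKE `θ^k` UNDER THE CLASS
# (the instance of file 7's abstract decay at the tower's quantities; real arithmetic only; model level; cell `pub-balaban`)

NE2 formalisation swarm `b2b-balaban-t4-ne2-formalise-*`, leaf prover 10 GEN 5 (`prover-b2b-balaban-t4-ne2-formalise-leaf-10-g5-0`, V-END holder lineage; staged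
23:46Z, filed unchanged in content by GEN 6 `prover-b2b-balaban-t4-ne2-formalise-leaf-10-g6-0`); item «V-AVG-G AT TAXI DATA», file 8 (journal NOTE l.22515, NEXT l.23033).
Composition BY NAME of file 7 ∕ 7b `VariationalColourTaxiOneMinDecayCore` ∕ `VariationalColourTaxiOneMinDecay.oneMin_outputs_le` (p240629 ∕ p241651) with file 6 `VariationalColourTaxiClassReadings` (p239775: the atom bounds), leaf-04-g5's `VariationalColourTaxiTowerEndClass.
{sumDefect_le_of_class, levelDefect_le_of_class, kappaV_inv_le, LambdaV_le_of_class}`, leaf-03-g7's `CompositeFibreMismatch.mismatch_twoStepTaxi_class` and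
`CovariantBlockReversePoincare.revPC_nonneg`; nothing defined.

CONTENT.  `oneMin_taxi_decay`: at level `k` of Bałaban's taxi tower in the class `(L^k)²a_k ≤ c`, `(L^{q+1})²b_q ≤ c` (`2 ≤ L`, `1 ≤ d`), with the rate `θ`
(`0 < θ ≤ 1`, `L⁻¹ ≤ θ²`) and the two polynomial smallness lines `hsm1` (parts 6–8's) and `hsm7` (file 6's `hcF` line), the `let` telescope of leaf-04-g7's
`VariationalColourTaxiTowerCentred.hONEm_taxi` (p238755) — written VERBATIM with its five free parameters `s = t = u = u₂ = w := θ^k` and the level plaquette bound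
`a := a k` — satisfies `0 ≤ ε`, `0 ≤ δ′`, `v ≤ V⋆`, `γ ≤ Γ⋆`, `0 ≤ ε₁ := (A−1) + A·ε + B ≤ C_ε⋆·θ^k`, `0 ≤ δ′₁ := √A·δ′ ≤ C_δ′⋆·θ^k`, the starred constants being
the statement's k-free `let`s in `d, L, c` and the displayed constants `C_D, C_D′, C_D₁, C_D₁′, Λ, C_P, C_R, C_Rv` (generic nonneg reals here; the END host puts the
(GF3) constants `CDs, CDs′` of part 7, the colour pair's, and part 8's `CRvs`).  The atom bounds are file 6's (`inv_sq_le`, `asq_nsq_le`, `m1_le`, `nm_le`, `m_le`,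
`frameDist_le`, `revPC_le_of_mul_le`, `kappa_gammaF_le_of_class`, `LambdaF_le_of_class`) plus §1's `nm1_le` (`n·m₁ ≤ 2(d−1)c·θ^{2k}`) and `LambdaSucc_le_of_class`
(the package constant `Λ_{k+1}` written with `b_k`, `≤ 4·lamV d ((d−1)c) d 0`).

HONEST FRAMING (T4-DAG p. 1).  Real arithmetic about OUR typed class constants; thresholds quantitatively void (memo GF3COV §3); nothing printed is a hypothesis; no
`def`, no `def … : Prop`, no `sorry`; axioms standard.  NOT an END statement; V-END with background ∕ NE2 NOT proved; NE3 OPEN; spine PROVED 0∕9 unchanged; rung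
(B)+1 on a fixed finite T⁴ — NOT infinite volume, NOT mass gap, NOT Clay.  HONEST DEPENDENCY (cell, verbatim): continuum YM on T⁴ ⇐ BetaPertH ∧ nine spine estimates
(0/9 proved); BetaPertH ⇐ (D1) ∧ (D4) ∧ CAP+tail; G-an2-4 gates asym, D1 and NE2/3/4.
-/

noncomputable section

namespace Summit.QuantumFields.BalabanUV.T4Continuum.VariationalColourTaxiTowerOneMinDecay

open Finset
open Summit.QuantumFields.BalabanUV.T4Continuum.VectorBlockTrialForm (kappaV kappaV_pos)
open Summit.QuantumFields.BalabanUV.T4Continuum.VariationalVectorForm (lamV lamV_nonneg)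
open Summit.QuantumFields.BalabanUV.T4Continuum.VariationalColourTaxiTransport (sumDefect_le_of_class levelDefect_le_of_class kappaV_inv_le LambdaV_le_of_class)
open Summit.QuantumFields.BalabanUV.T4Continuum.VariationalColourTaxiTowerAvgGDecay (first_order_le)
open Summit.QuantumFields.BalabanUV.T4Continuum.VariationalColourTaxiClassReadings (inv_sq_le asq_nsq_le m1_le nm_le m_le frameDist_le revPC_le_of_mul_le kappa_gammaF_le_of_class LambdaF_le_of_class)
open Summit.QuantumFields.BalabanUV.T4Continuum.CompositeFibreMismatch (mismatch_twoStepTaxi_class)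
open Summit.QuantumFields.BalabanUV.T4Continuum.CovariantBlockReversePoincare (revPC revPC_nonneg)
open Summit.QuantumFields.BalabanUV.T4Continuum.VariationalColourTaxiOneMinDecay (oneMin_outputs_le)

variable {d : ℕ} (L : ℕ)

/-! ## §1 Two more class readings -/

/-- `n·m₁,k ≤ 2(d−1)c·t²` (`t = θ^k`). [folklore] -/
theorem nm1_le (hL : 1 ≤ L) {a b c θ : ℝ} {k : ℕ} (hθL : (L : ℝ)⁻¹ ≤ θ ^ 2) (ha0 : 0 ≤ a) (hb0 : 0 ≤ b) (hac : (((L ^ k : ℕ)) : ℝ) ^ 2 * a ≤ c)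
    (hbc : (((L ^ (k + 1) : ℕ)) : ℝ) ^ 2 * b ≤ c) :
    ((L ^ k : ℕ) : ℝ) * (((d - 1 : ℕ) : ℝ) * ((L - 1 : ℕ) : ℝ) * ((2 * L - 1 : ℕ) : ℝ) * b) ≤ (2 * ((d - 1 : ℕ) : ℝ) * c) * (θ ^ k) ^ 2 := by
  have hL0 : (0 : ℝ) ≤ L := Nat.cast_nonneg L
  have hN0 : (0 : ℝ) ≤ ((L ^ k : ℕ) : ℝ) := Nat.cast_nonneg _
  have hL1r : ((L - 1 : ℕ) : ℝ) ≤ L := by exact_mod_cast Nat.sub_le L 1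
  have h2L1 : ((2 * L - 1 : ℕ) : ℝ) ≤ 2 * L := by exact_mod_cast Nat.sub_le (2 * L) 1
  have hNLLb := (first_order_le L hL hθL k ha0 hbc hac).1
  have h1 : ((d - 1 : ℕ) : ℝ) * ((L - 1 : ℕ) : ℝ) * ((2 * L - 1 : ℕ) : ℝ) * b ≤ ((d - 1 : ℕ) : ℝ) * (2 * ((L : ℝ) * L * b)) := by
    have h0 : 0 ≤ ((d - 1 : ℕ) : ℝ) := Nat.cast_nonneg _
    calc ((d - 1 : ℕ) : ℝ) * ((L - 1 : ℕ) : ℝ) * ((2 * L - 1 : ℕ) : ℝ) * b = ((d - 1 : ℕ) : ℝ) * (((L - 1 : ℕ) : ℝ) * ((2 * L - 1 : ℕ) : ℝ) * b) := by ring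
      _ ≤ ((d - 1 : ℕ) : ℝ) * ((L : ℝ) * (2 * L) * b) := mul_le_mul_of_nonneg_left (mul_le_mul_of_nonneg_right (mul_le_mul hL1r h2L1 (Nat.cast_nonneg _) hL0) hb0) h0
      _ = ((d - 1 : ℕ) : ℝ) * (2 * ((L : ℝ) * L * b)) := by ring
  calc ((L ^ k : ℕ) : ℝ) * (((d - 1 : ℕ) : ℝ) * ((L - 1 : ℕ) : ℝ) * ((2 * L - 1 : ℕ) : ℝ) * b)
      ≤ ((L ^ k : ℕ) : ℝ) * (((d - 1 : ℕ) : ℝ) * (2 * ((L : ℝ) * L * b))) := mul_le_mul_of_nonneg_left h1 hN0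
    _ = 2 * ((d - 1 : ℕ) : ℝ) * (((L ^ k : ℕ) : ℝ) * ((L : ℝ) * L * b)) := by ring
    _ ≤ 2 * ((d - 1 : ℕ) : ℝ) * (c * (θ ^ k) ^ 2) := mul_le_mul_of_nonneg_left hNLLb (by positivity)
    _ = (2 * ((d - 1 : ℕ) : ℝ) * c) * (θ ^ k) ^ 2 := by ring

/-- **THE PACKAGE CONSTANT `Λ_{k+1}` WRITTEN WITH `b_k`** (the level-(k+1) plaquette bound of `Rlev (k+1)` IS `b_k`): `κᵥ(L^{k+1})⁻¹(S_{k+1} + 3(d−1)L^{k+1}(L^{k+1}−1)b_k) ≤ ½`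
and `Λf ≤ 4·lamV d ((d−1)c) d 0`. [folklore] -/
theorem LambdaSucc_le_of_class (hL : 2 ≤ L) (hd : 1 ≤ d) {b : ℕ → ℝ} {c : ℝ} (hb0 : ∀ q, 0 ≤ b q) (hbc : ∀ q, (((L ^ (q + 1) : ℕ)) : ℝ) ^ 2 * b q ≤ c)
    (hsm1 : 60 * (6 : ℝ) ^ (d - 1) * ((2 * ((((d - 1 : ℕ) : ℝ) + (d : ℝ) * d)) + 3 * ((d - 1 : ℕ) : ℝ)) * c) ≤ 1 / 2) (k : ℕ) :
    (kappaV d (L ^ (k + 1)))⁻¹ * ((∑ q ∈ Finset.range (k + 1), ((((d - 1 : ℕ) : ℝ) + (d : ℝ) * d) * (((L : ℝ) * ((L ^ q - 1 : ℕ) : ℝ) * ((L - 1 : ℕ) : ℝ)) * b q)))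
              + 3 * (((d - 1 : ℕ) : ℝ) * (L ^ (k + 1) : ℕ) * ((L ^ (k + 1) - 1 : ℕ) : ℝ) * b k)) ≤ 1 / 2
    ∧ (lamV d ((L ^ (k + 1) : ℕ) * (((d - 1 : ℕ) : ℝ) * ((L ^ (k + 1) - 1 : ℕ) : ℝ) * b k)) d (((L ^ (k + 1) : ℕ) : ℝ) ^ 2 * 0)
          / (1 - (kappaV d (L ^ (k + 1)))⁻¹ * ((∑ q ∈ Finset.range (k + 1), ((((d - 1 : ℕ) : ℝ) + (d : ℝ) * d) * (((L : ℝ) * ((L ^ q - 1 : ℕ) : ℝ) * ((L - 1 : ℕ) : ℝ)) * b q)))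
              + 3 * (((d - 1 : ℕ) : ℝ) * (L ^ (k + 1) : ℕ) * ((L ^ (k + 1) - 1 : ℕ) : ℝ) * b k))) ^ 2)
      ≤ (4 * lamV d (((d - 1 : ℕ) : ℝ) * c) (d : ℝ) 0) := by
  have hpos : 0 < L ^ (k + 1) := pow_pos (by omega) _
  have hκ := kappaV_inv_le (d := d) hd hpos
  have hS := sumDefect_le_of_class (d := d) L hL hb0 hbc (k + 1)
  have hT := levelDefect_le_of_class (d := d) L (k + 1) (hb0 k) (hbc k)
  have hbk := hb0 k
  have hD0 : (0 : ℝ) ≤ ((d - 1 : ℕ) : ℝ) := Nat.cast_nonneg _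
  have hS0 : 0 ≤ (∑ q ∈ Finset.range (k + 1), ((((d - 1 : ℕ) : ℝ) + (d : ℝ) * d) * (((L : ℝ) * ((L ^ q - 1 : ℕ) : ℝ) * ((L - 1 : ℕ) : ℝ)) * b q))) := Finset.sum_nonneg fun q _ => by have := hb0 q; positivity
  have hsum0 : 0 ≤ ((∑ q ∈ Finset.range (k + 1), ((((d - 1 : ℕ) : ℝ) + (d : ℝ) * d) * (((L : ℝ) * ((L ^ q - 1 : ℕ) : ℝ) * ((L - 1 : ℕ) : ℝ)) * b q)))
              + 3 * (((d - 1 : ℕ) : ℝ) * (L ^ (k + 1) : ℕ) * ((L ^ (k + 1) - 1 : ℕ) : ℝ) * b k)) := by positivity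
  have ht : (kappaV d (L ^ (k + 1)))⁻¹ * ((∑ q ∈ Finset.range (k + 1), ((((d - 1 : ℕ) : ℝ) + (d : ℝ) * d) * (((L : ℝ) * ((L ^ q - 1 : ℕ) : ℝ) * ((L - 1 : ℕ) : ℝ)) * b q)))
              + 3 * (((d - 1 : ℕ) : ℝ) * (L ^ (k + 1) : ℕ) * ((L ^ (k + 1) - 1 : ℕ) : ℝ) * b k)) ≤ 1 / 2 := by
    calc (kappaV d (L ^ (k + 1)))⁻¹ * ((∑ q ∈ Finset.range (k + 1), ((((d - 1 : ℕ) : ℝ) + (d : ℝ) * d) * (((L : ℝ) * ((L ^ q - 1 : ℕ) : ℝ) * ((L - 1 : ℕ) : ℝ)) * b q)))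
              + 3 * (((d - 1 : ℕ) : ℝ) * (L ^ (k + 1) : ℕ) * ((L ^ (k + 1) - 1 : ℕ) : ℝ) * b k))
        ≤ (60 * (6 : ℝ) ^ (d - 1)) * (2 * ((((d - 1 : ℕ) : ℝ) + (d : ℝ) * d) * c) + 3 * (((d - 1 : ℕ) : ℝ) * c)) := mul_le_mul hκ (add_le_add hS hT) hsum0 (by positivity)
      _ = 60 * (6 : ℝ) ^ (d - 1) * ((2 * ((((d - 1 : ℕ) : ℝ) + (d : ℝ) * d)) + 3 * ((d - 1 : ℕ) : ℝ)) * c) := by ring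
      _ ≤ 1 / 2 := hsm1
  refine ⟨ht, ?_⟩
  have hn1r : ((L ^ (k + 1) - 1 : ℕ) : ℝ) ≤ ((L ^ (k + 1) : ℕ) : ℝ) := by exact_mod_cast Nat.sub_le (L ^ (k + 1)) 1
  have hx0 : 0 ≤ ((L ^ (k + 1) : ℕ) : ℝ) * (((d - 1 : ℕ) : ℝ) * ((L ^ (k + 1) - 1 : ℕ) : ℝ) * b k) := by positivity
  have hx : ((L ^ (k + 1) : ℕ) : ℝ) * (((d - 1 : ℕ) : ℝ) * ((L ^ (k + 1) - 1 : ℕ) : ℝ) * b k) ≤ ((d - 1 : ℕ) : ℝ) * c := by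
    calc ((L ^ (k + 1) : ℕ) : ℝ) * (((d - 1 : ℕ) : ℝ) * ((L ^ (k + 1) - 1 : ℕ) : ℝ) * b k)
        = ((d - 1 : ℕ) : ℝ) * ((((L ^ (k + 1) : ℕ) : ℝ) * ((L ^ (k + 1) - 1 : ℕ) : ℝ)) * b k) := by ring
      _ ≤ ((d - 1 : ℕ) : ℝ) * ((((L ^ (k + 1) : ℕ) : ℝ) * ((L ^ (k + 1) : ℕ) : ℝ)) * b k) :=
          mul_le_mul_of_nonneg_left (mul_le_mul_of_nonneg_right (mul_le_mul_of_nonneg_left hn1r (Nat.cast_nonneg _)) hbk) hD0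
      _ = ((d - 1 : ℕ) : ℝ) * ((((L ^ (k + 1) : ℕ)) : ℝ) ^ 2 * b k) := by ring
      _ ≤ ((d - 1 : ℕ) : ℝ) * c := mul_le_mul_of_nonneg_left (hbc k) hD0
  exact LambdaV_le_of_class (d := d) (CG := (d : ℝ)) (CGs := (d : ℝ)) hx0 hx (Nat.cast_nonneg d) le_rfl (le_of_eq (mul_zero _).symm) (le_of_eq (mul_zero _)) ht

/-! ## §2 The instance -/

/-- **THE (ONE-min) COSTS AT BAŁABAN's TAXI DATA DECAY LIKE `θ^k`** — `hONEm_taxi`'s `let` telescope (p238755) with `s = t = u = u₂ = w := θ^k`, `a := a k`,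
bounded by file 7b's `oneMin_outputs_le` at the tower's atoms with file 6's atom bounds. [folklore] -/
theorem oneMin_taxi_decay (hL : 2 ≤ L) (hd : 1 ≤ d) {a b : ℕ → ℝ} {c : ℝ} (ha0 : ∀ k, 0 ≤ a k) (hb0 : ∀ k, 0 ≤ b k)
    (hac : ∀ k, (((L ^ k : ℕ)) : ℝ) ^ 2 * a k ≤ c) (hbc : ∀ k, (((L ^ (k + 1) : ℕ)) : ℝ) ^ 2 * b k ≤ c)
    (hsm1 : 60 * (6 : ℝ) ^ (d - 1) * ((2 * ((((d - 1 : ℕ) : ℝ) + (d : ℝ) * d)) + 3 * ((d - 1 : ℕ) : ℝ)) * c) ≤ 1 / 2)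
    (hsm7 : 60 * (6 : ℝ) ^ (d - 1) * ((2 * ((((d - 1 : ℕ) : ℝ)) + (d : ℝ) * d) + 5 * ((d - 1 : ℕ) : ℝ)) * c) ≤ 1 / 2)
    {θ : ℝ} (hθ0 : 0 < θ) (hθ1 : θ ≤ 1) (hθL : (L : ℝ)⁻¹ ≤ θ ^ 2)
    {CD CD' CD₁ CD₁' Λ CP CR CRv : ℝ} (hCD : 0 ≤ CD) (hCD' : 0 ≤ CD') (hCD₁ : 0 ≤ CD₁) (hCD₁' : 0 ≤ CD₁') (hΛ : 0 ≤ Λ) (hCP : 0 ≤ CP) (hCR : 0 ≤ CR) (hCRv : 0 ≤ CRv)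
    (k : ℕ) :
    let eH : ℝ := (((d : ℝ) / 4 + 1 / 2) * ((L : ℝ) / ((L ^ k : ℕ) : ℝ) ^ 2)) * CR * (Λ + 1)
        + 2 * (Real.sqrt (2 * d * (1 + (d : ℝ) ^ 2)) * (((L ^ k : ℕ) : ℝ) * L * (((d - 1 : ℕ) : ℝ) * ((L - 1 : ℕ) : ℝ) * ((2 * L - 1 : ℕ) : ℝ) * b k)))
          * Real.sqrt ((Λ + (((d : ℝ) / 4 + 1 / 2) * ((L : ℝ) / ((L ^ k : ℕ) : ℝ) ^ 2)) * CR * (Λ + 1)) * (CP * (Λ + 1)))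
        + (Real.sqrt (2 * d * (1 + (d : ℝ) ^ 2)) * (((L ^ k : ℕ) : ℝ) * L * (((d - 1 : ℕ) : ℝ) * ((L - 1 : ℕ) : ℝ) * ((2 * L - 1 : ℕ) : ℝ) * b k))) ^ 2 * (CP * (Λ + 1))
        + 2 * (Real.sqrt d * (((L ^ k : ℕ) : ℝ) * (((d - 1 : ℕ) : ℝ) * L * ((L - 1 : ℕ) : ℝ) * b k))) * Real.sqrt (Λ * (CP * (Λ + 1)))
    let e₂ : ℝ := θ ^ k + 3 * (1 + (θ ^ k)⁻¹) * (8 * d * ((((L ^ k : ℕ) : ℝ) ^ 2)⁻¹ * CRv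
          + (1 + (((d - 1 : ℕ) : ℝ) * ((L - 1 : ℕ) : ℝ) * ((2 * L - 1 : ℕ) : ℝ) * b k)) ^ 2 * ((d : ℝ) / 4 * L * ((((L ^ k : ℕ) : ℝ) ^ 2)⁻¹ * CRv)) + (((d - 1 : ℕ) : ℝ) * ((L - 1 : ℕ) : ℝ) * ((2 * L - 1 : ℕ) : ℝ) * b k) ^ 2 * ((2 * (1 + CD)) + (2 * (CD' + d * ((((L ^ k : ℕ) : ℝ)) ^ 2 * a k) * 64)))
          + (((d - 1 : ℕ) : ℝ) * ((L - 1 : ℕ) : ℝ) * ((2 * L - 1 : ℕ) : ℝ) * b k) ^ 2 * (2 * (1 + (d : ℝ) ^ 2) * (L : ℝ) ^ 2 * (((L ^ k : ℕ) : ℝ) ^ 2 * (max (40 * (2 * (1 + CD))) (64 + 40 * (2 * (CD' + d * ((((L ^ k : ℕ) : ℝ)) ^ 2 * a k) * 64)))))))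
        + (d : ℝ) / 2 * (2 * d * ((((L ^ k : ℕ) : ℝ) ^ 2)⁻¹ * CRv) + 2 * (d : ℝ) ^ 2 * a k ^ 2 * (((L ^ k : ℕ) : ℝ) ^ 2 * (max (40 * (2 * (1 + CD))) (64 + 40 * (2 * (CD' + d * ((((L ^ k : ℕ) : ℝ)) ^ 2 * a k) * 64))))))
        + (d : ℝ) / 4 * (2 * (2 * d * ((((L ^ k : ℕ) : ℝ) ^ 2)⁻¹ * CRv) + 2 * (d : ℝ) ^ 2 * a k ^ 2 * (((L ^ k : ℕ) : ℝ) ^ 2 * (max (40 * (2 * (1 + CD))) (64 + 40 * (2 * (CD' + d * ((((L ^ k : ℕ) : ℝ)) ^ 2 * a k) * 64)))))) + 2 * (Λ * (((L ^ k : ℕ) : ℝ) ^ 2)⁻¹ * (CD + CD')))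
        + CP * eH * (CD + CD'))
    let ε : ℝ := θ ^ k + (1 + θ ^ k) * ((θ ^ k + (1 + (θ ^ k)⁻¹) * (d * (L : ℝ) / ((L ^ k : ℕ) : ℝ) ^ 2)) * (1 + CRv) + e₂)
      + (1 + (θ ^ k)⁻¹) * ((lamV d ((L ^ k * L : ℕ) * (((d - 1 : ℕ) : ℝ) * ((L - 1 : ℕ) : ℝ) * ((2 * L - 1 : ℕ) : ℝ) * b k + ((d - 1 : ℕ) : ℝ) * ((L ^ k - 1 : ℕ) : ℝ) * a k)) d (((L ^ k * L : ℕ) : ℝ) ^ 2 * 0) / (1 - (kappaV d (L ^ k * L))⁻¹ * ((∑ q ∈ Finset.range k, ((((d - 1 : ℕ) : ℝ) + (d : ℝ) * d) * (((L : ℝ) * ((L ^ q - 1 : ℕ) : ℝ) * ((L - 1 : ℕ) : ℝ)) * b q))) + 3 * (((d - 1 : ℕ) : ℝ) * (L ^ k : ℕ) * ((L ^ k - 1 : ℕ) : ℝ) * a k) + ((d - 1 : ℕ) : ℝ) * ((L ^ k - 1 : ℕ) : ℝ) * ((2 * L ^ k - 1 : ℕ) : ℝ) * a k)) ^ 2)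 * (25 / 4 * ((((L ^ k : ℕ) : ℝ) ^ 2)⁻¹ * ((2 * (1 + CD)) + (2 * (CD' + d * ((((L ^ k : ℕ) : ℝ)) ^ 2 * a k) * 64))))))
    let δ' : ℝ := Real.sqrt (8 * d * (1 + (d : ℝ) ^ 2)) * (((L ^ k : ℕ) : ℝ) * L * (((d - 1 : ℕ) : ℝ) * ((L - 1 : ℕ) : ℝ) * ((2 * L - 1 : ℕ) : ℝ) * b k))
    let v : ℝ := (1 + (θ ^ k)⁻¹) * (4 * ((d : ℝ) * ((d : ℝ) * (((L : ℝ) * ((L ^ k - 1 : ℕ) : ℝ) * ((L - 1 : ℕ) : ℝ)) * b k)))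
          * revPC d (L ^ k * L) (((d - 1 : ℕ) : ℝ) * ((L - 1 : ℕ) : ℝ) * ((2 * L - 1 : ℕ) : ℝ) * b k + ((d - 1 : ℕ) : ℝ) * ((L ^ k - 1 : ℕ) : ℝ) * a k)) ^ 2
        * ((d : ℝ) * ((2 * (1 + CD₁)) + (2 * (CD₁' + d * ((((L ^ (k + 1) : ℕ) : ℝ)) ^ 2 * b k) * 64))))
    let γ : ℝ := (3 * (((d - 1 : ℕ) : ℝ) * L * ((L - 1 : ℕ) : ℝ) * b k)) ^ 2 * max (40 * (2 * (1 + CD₁))) (64 + 40 * (2 * (CD₁' + d * ((((L ^ (k + 1) : ℕ) : ℝ)) ^ 2 * b k) * 64)))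
    let Λf : ℝ := lamV d ((L ^ (k + 1) : ℕ) * (((d - 1 : ℕ) : ℝ) * ((L ^ (k + 1) - 1 : ℕ) : ℝ) * b k)) d (((L ^ (k + 1) : ℕ) : ℝ) ^ 2 * 0)
          / (1 - (kappaV d (L ^ (k + 1)))⁻¹ * ((∑ q ∈ Finset.range (k + 1), ((((d - 1 : ℕ) : ℝ) + (d : ℝ) * d) * (((L : ℝ) * ((L ^ q - 1 : ℕ) : ℝ) * ((L - 1 : ℕ) : ℝ)) * b q)))
              + 3 * (((d - 1 : ℕ) : ℝ) * (L ^ (k + 1) : ℕ) * ((L ^ (k + 1) - 1 : ℕ) : ℝ) * b k))) ^ 2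
    let A : ℝ := (1 + θ ^ k + (1 + (θ ^ k)⁻¹) * (Λf * γ) * (1 + 4 * γ)) * (1 + 4 * v) * (1 + θ ^ k)
    let B : ℝ := (1 + θ ^ k + (1 + (θ ^ k)⁻¹) * (Λf * γ) * (1 + 4 * γ)) * (1 + 4 * v) * (4 * v) + 4 * ((1 + (θ ^ k)⁻¹) * (Λf * γ))

    -- the starred constants (k-free)
    let EHs : ℝ := ((((d : ℝ) / 4 + 1 / 2) * L) * CR * (Λ + 1)
          + 2 * (Real.sqrt (2 * d * (1 + (d : ℝ) ^ 2)) * (L * (2 * ((d - 1 : ℕ) : ℝ) * c))) * Real.sqrt ((Λ + (((d : ℝ) / 4 + 1 / 2) * L) * CR * (Λ + 1)) * (CP * (Λ + 1)))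
          + (Real.sqrt (2 * d * (1 + (d : ℝ) ^ 2)) * (L * (2 * ((d - 1 : ℕ) : ℝ) * c))) ^ 2 * (CP * (Λ + 1))
          + 2 * (Real.sqrt d * (((d - 1 : ℕ) : ℝ) * c)) * Real.sqrt (Λ * (CP * (Λ + 1))))
    let E2s : ℝ := (1 + 6 * ((8 * d * (CRv + (1 + (2 * ((d - 1 : ℕ) : ℝ) * c)) ^ 2 * ((d : ℝ) / 4 * L * CRv) + (2 * ((d - 1 : ℕ) : ℝ) * c) ^ 2 * ((2 * (1 + CD)) + (2 * (CD' + d * c * 64))) + 2 * (1 + (d : ℝ) ^ 2) * (L : ℝ) ^ 2 * ((2 * ((d - 1 : ℕ) : ℝ) * c) ^ 2 * (max (40 * (2 * (1 + CD))) (64 + 40 * (2 * (CD' + d * c * 64))))))) + ((d : ℝ) / 2 * (2 * d * CRv + 2 * (d : ℝ) ^ 2 * (c ^ 2 * (max (40 * (2 * (1 + CD))) (64 + 40 * (2 * (CD' + d * c * 64))))))) + ((d : ℝ) / 4 * (2 * (2 * d * CRv + 2 * (d : ℝ) ^ 2 * (c ^ 2 * (max (40 * (2 * (1 + CD))) (64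 + 40 * (2 * (CD' + d * c * 64)))))) + 2 * (Λ * (CD + CD')))) + (CP * EHs * (CD + CD'))))
    let EPSs : ℝ := (1 + 2 * ((1 + 2 * (d * (L : ℝ))) * (1 + CRv) + E2s) + 2 * ((4 * lamV d (((d - 1 : ℕ) : ℝ) * (3 * L * c)) (d : ℝ) 0) * (25 / 4 * ((2 * (1 + CD)) + (2 * (CD' + d * c * 64))))))
    let Vs : ℝ := (2 * ((4 * ((d : ℝ) * ((d : ℝ) * c)) * (4 * d * (36 : ℝ) ^ d * (1 + 3 * ((d - 1 : ℕ) : ℝ) * L * c) ^ 2)) ^ 2 * ((d : ℝ) * ((2 * (1 + CD₁)) + (2 * (CD₁' + d * c * 64))))))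
    let Gs : ℝ := ((3 * (((d - 1 : ℕ) : ℝ) * c)) ^ 2 * (max (40 * (2 * (1 + CD₁))) (64 + 40 * (2 * (CD₁' + d * c * 64)))))
    let DPRs : ℝ := (Real.sqrt (8 * d * (1 + (d : ℝ) ^ 2)) * (L * (2 * ((d - 1 : ℕ) : ℝ) * c)))
    let p : ℝ := (1 + 2 * ((4 * lamV d (((d - 1 : ℕ) : ℝ) * c) (d : ℝ) 0) * Gs) * (1 + 4 * Gs))
    let As : ℝ := (1 + p) * (1 + 4 * Vs) * 2
    0 ≤ ε ∧ 0 ≤ δ' ∧ v ≤ Vs ∧ γ ≤ Gs ∧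
      0 ≤ (A - 1) + A * ε + B ∧ (A - 1) + A * ε + B ≤ ((1 + 2 * p + 8 * Vs + 8 * p * Vs) + As * EPSs + (4 * Vs * ((1 + p) * (1 + 4 * Vs)) + 8 * ((4 * lamV d (((d - 1 : ℕ) : ℝ) * c) (d : ℝ) 0) * Gs))) * θ ^ k ∧
      0 ≤ Real.sqrt A * δ' ∧ Real.sqrt A * δ' ≤ (Real.sqrt As * DPRs) * θ ^ k := by
  intro eH e₂ ε δ' v γ Λf A B EHs E2s EPSs Vs Gs DPRs p As
  have hL1 : 1 ≤ L := le_trans (by norm_num) hL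
  have hτ0 : 0 < θ ^ k := pow_pos hθ0 k
  have hτ1 : θ ^ k ≤ 1 := pow_le_one₀ hθ0.le hθ1
  have hN0 : (0 : ℝ) < ((L ^ k : ℕ) : ℝ) := by exact_mod_cast pow_pos (by omega) k
  have hd0 : (0 : ℝ) ≤ d := Nat.cast_nonneg d
  have hD0 : (0 : ℝ) ≤ ((d - 1 : ℕ) : ℝ) := Nat.cast_nonneg _
  have hL0 : (0 : ℝ) ≤ L := Nat.cast_nonneg L
  have hak := ha0 k
  have hbk := hb0 k
  have hc0 : 0 ≤ c := le_trans (by positivity) (hac k)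
  have hcast : (((L ^ (k + 1) : ℕ)) : ℝ) = ((L ^ k * L : ℕ) : ℝ) := by rw [pow_succ]
  have hbc' : ((((L ^ k * L : ℕ)) : ℝ)) ^ 2 * b k ≤ c := by rw [← hcast]; exact hbc k
  -- the atom bounds (file 6 + §1)
  have hNi := inv_sq_le L hL1 hθL k
  have haN := asq_nsq_le L hL1 hθL hak (hac k)
  have hX0 : 0 ≤ (((d - 1 : ℕ) : ℝ) * ((L - 1 : ℕ) : ℝ) * ((2 * L - 1 : ℕ) : ℝ) * b k) := by positivity
  have hXN := nm1_le (d := d) L hL1 hθL hak hbk (hac k) (hbc k)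
  have hX := m1_le (d := d) L hL1 hθL hbk (hbc k) (k := k)
  have hY0 : 0 ≤ (((d - 1 : ℕ) : ℝ) * L * ((L - 1 : ℕ) : ℝ) * b k) := by positivity
  have hYN := nm_le (d := d) L hL1 hθL hak hbk (hac k) (hbc k)
  have hY := m_le (d := d) L hL1 hθL hbk (hbc k) (k := k)
  have hF0 : 0 ≤ (((L : ℝ) * ((L ^ k - 1 : ℕ) : ℝ) * ((L - 1 : ℕ) : ℝ)) * b k) := by positivity
  have hF := frameDist_le L hL1 hθL hak hbk (hac k) (hbc k)
  have hw0 : 0 ≤ (((d - 1 : ℕ) : ℝ) * ((L - 1 : ℕ) : ℝ) * ((2 * L - 1 : ℕ) : ℝ) * b k + ((d - 1 : ℕ) : ℝ) * ((L ^ k - 1 : ℕ) : ℝ) * a k) := by positivity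
  have hw := mismatch_twoStepTaxi_class (d := d) L k hL1 hbk hak hbc' (hac k)
  have hR0 : 0 ≤ revPC d (L ^ k * L) (((d - 1 : ℕ) : ℝ) * ((L - 1 : ℕ) : ℝ) * ((2 * L - 1 : ℕ) : ℝ) * b k + ((d - 1 : ℕ) : ℝ) * ((L ^ k - 1 : ℕ) : ℝ) * a k) := revPC_nonneg _ _
  have hR := revPC_le_of_mul_le (d := d) hw0 hw
  have hNB0 : 0 ≤ ((((L ^ (k + 1) : ℕ) : ℝ)) ^ 2 * b k) := by positivity
  have ht : (kappaV d (L ^ k * L))⁻¹ * ((∑ q ∈ Finset.range k, ((((d - 1 : ℕ) : ℝ) + (d : ℝ) * d) * (((L : ℝ) * ((L ^ q - 1 : ℕ) : ℝ) * ((L - 1 : ℕ) : ℝ)) * b q))) + 3 * (((d - 1 : ℕ) : ℝ) * (L ^ k : ℕ) * ((L ^ k - 1 : ℕ) : ℝ) * a k) + ((d - 1 : ℕ) : ℝ) * ((L ^ k - 1 : ℕ) : ℝ) * ((2 * L ^ k - 1 : ℕ) : ℝ) * a k) ≤ 1 / 2 := (kappa_gammaF_le_of_class (d := d) L hL hd ha0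 hb0 hac hbc k).trans hsm7
  have hLv0 : 0 ≤ (lamV d ((L ^ k * L : ℕ) * (((d - 1 : ℕ) : ℝ) * ((L - 1 : ℕ) : ℝ) * ((2 * L - 1 : ℕ) : ℝ) * b k + ((d - 1 : ℕ) : ℝ) * ((L ^ k - 1 : ℕ) : ℝ) * a k)) d (((L ^ k * L : ℕ) : ℝ) ^ 2 * 0) / (1 - (kappaV d (L ^ k * L))⁻¹ * ((∑ q ∈ Finset.range k, ((((d - 1 : ℕ) : ℝ) + (d : ℝ) * d) * (((L : ℝ) * ((L ^ q - 1 : ℕ) : ℝ) * ((L - 1 : ℕ) : ℝ)) * b q))) + 3 * (((d - 1 : ℕ) : ℝ) * (L ^ k : ℕ) * ((L ^ k - 1 : ℕ) : ℝ) * a k) + ((d - 1 : ℕ) : ℝ) * ((L ^ k - 1 : ℕ) : ℝ) * ((2 * L ^ k - 1 : ℕ) : ℝ) * a k)) ^ 2) := div_nonneg (lamV_nonneg hd0 (le_of_eq (mul_zero _).symm)) (sq_nonneg _)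
  have hLv := LambdaF_le_of_class (d := d) L hL1 k hak hbk (hac k) hbc' ht
  obtain ⟨-, hLf⟩ := LambdaSucc_le_of_class (d := d) L hL hd hb0 hbc hsm1 k
  have hLf0 : 0 ≤ (lamV d ((L ^ (k + 1) : ℕ) * (((d - 1 : ℕ) : ℝ) * ((L ^ (k + 1) - 1 : ℕ) : ℝ) * b k)) d (((L ^ (k + 1) : ℕ) : ℝ) ^ 2 * 0)
          / (1 - (kappaV d (L ^ (k + 1)))⁻¹ * ((∑ q ∈ Finset.range (k + 1), ((((d - 1 : ℕ) : ℝ) + (d : ℝ) * d) * (((L : ℝ) * ((L ^ q - 1 : ℕ) : ℝ) * ((L - 1 : ℕ) : ℝ)) * b q)))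
              + 3 * (((d - 1 : ℕ) : ℝ) * (L ^ (k + 1) : ℕ) * ((L ^ (k + 1) - 1 : ℕ) : ℝ) * b k))) ^ 2) := div_nonneg (lamV_nonneg hd0 (le_of_eq (mul_zero _).symm)) (sq_nonneg _)
  exact oneMin_outputs_le (d := d) (L := L) (τ := θ ^ k) (N := ((L ^ k : ℕ) : ℝ)) (a := a k) hτ0 hτ1 hN0 hNi hak (hac k) haN hX0 (by positivity) hXN hX
    hY0 (by positivity) hYN hY hF0 hF hR0 hR hNB0 (hbc k) hLv0 hLv hLf0 hLf hΛ hCP hCR hCRv hCD hCD' hCD₁ hCD₁' hc0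

end Summit.QuantumFields.BalabanUV.T4Continuum.VariationalColourTaxiTowerOneMinDecay

end
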